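import Summits.HodgeConjecture.CorCM.IrreducibleOddWeightsWielandt
import HarnessLib

/-!
# The Schur test: the odd weights are irreducible iff every odd-valued equivariant endomorphism is zero or injective on
# them — with Wielandt's expansion, iff no non-trivial combination `c₀P + Σ c_jT_j` kills an odd vector

COR-CM (cell `pub-hodgecm2`, binder seat `b16` gen 55, count-neutral claim IRR-ODD, file F8 — abstract `G`-set level,
sequel of F1 `CorCM/IrreducibleOddWeights`, F5 `…Dichotomy`, F7 `…Wielandt`; theorems only, no definition, no named
fact, no `sorry`).  NEW as stated, hence under `Summits/`.  HONEST FRAMING: finite-dimensional linear algebra (Schur's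
lemma and its converse for the permutation module); `HC_CM` is neither used nor asserted.

* **`irreducible_iff_forall_ker`** — for a conjugation `ρ` commuting with `G` (no transitivity, no orbit data): the
  `ρ`-odd weights `Anti` are IRREDUCIBLE iff every `G`-equivariant endomorphism of `ℚ^X` with odd values that kills a
  non-zero odd vector kills all of `Anti` (⟹ Schur, F1; ⟸ the equivariant orthogonal projection onto a proper stable
  subspace, F5, kills its complement but not the subspace).  Equivalently: the commutant `D` acts on `Anti` without
  zero divisors — `D` is a division algebra.
* **`irreducible_iff_forall_coeffs`** — `G` transitive, `y_1, …, y_p` representing the non-self-conjugate orbit pairs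
  of `Stab(x₀)` (the rest self-conjugate), `T_j` the orbital operators (F3/F7): (IRR) iff for all rationals
  `c₀, c_1, …, c_p`, if `c₀·(v − v∘ρ) + Σ_j c_j·T_j v = 0` for some non-zero odd `v` then it vanishes for every odd `v`
  — by Wielandt's expansion (F7) these combinations are ALL the odd-valued equivariant endomorphisms.  For `p = 1` this
  is F7's eigenvector test; in general it is a finite computation on a Galois model (the `(p+1)`-dimensional algebra
  `D` has no zero divisors in its action on `Anti`).

## References

* [Serre1977] J.-P. Serre, *Linear Representations of Finite Groups*, GTM 42 (1977), §1.3 Thm. 1, §2.2 Prop. 4.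
* [Wielandt1964] H. Wielandt, *Finite Permutation Groups* (1964), Thm. 28.4, §29.
-/

set_option autoImplicit false

noncomputable section

open scoped BigOperators

universe u v w

namespace Summit.HodgeConjecture.CorCM.IrrOdd

open Literature.NumberTheory.ComplexMultiplication

variable {G : Type w} [Group G] {I : Type u} {X : Type v} [MulAction G X]

open scoped Classical

section SchurTest

variable [Fintype X] {ρ : G}

/-- **THE SCHUR TEST.**  For a conjugation `ρ` commuting with `G`: the `ρ`-odd weights are irreducible IFF every
`G`-equivariant endomorphism of `ℚ^X` with `ρ`-odd values killing one non-zero odd vector kills every odd vector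
(the commutant acts without zero divisors). [cite: Serre1977, §1.3 Thm. 1 and §2.2 Prop. 4] -/
theorem irreducible_iff_forall_ker (hc : ∀ (g : G) (x : X), g • ρ • x = ρ • g • x) :
    (∀ W : Submodule ℚ (X → ℚ), W ≤ antiWeights (E := X) ρ → W ≠ ⊥ →
      (∀ (k : G) (f : X → ℚ), f ∈ W → (fun y => f (k • y)) ∈ W) → W = antiWeights (E := X) ρ) ↔
    ∀ S : (X → ℚ) →ₗ[ℚ] (X → ℚ),
      (∀ (g : G) (f : X → ℚ), S (fun x => f (g⁻¹ • x)) = fun x => S f (g⁻¹ • x)) →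
      (∀ (f : X → ℚ) (x : X), S f (ρ • x) = -S f x) →
      ∀ a ∈ antiWeights (E := X) ρ, a ≠ 0 → S a = 0 → ∀ b ∈ antiWeights (E := X) ρ, S b = 0 := by
  have hmemA : ∀ f : X → ℚ, f ∈ antiWeights (E := X) ρ ↔ ∀ x, f (ρ • x) = -f x := fun f => Iff.rfl
  have hAst : ∀ (k : G) (f : X → ℚ), f ∈ antiWeights (E := X) ρ → (fun x => f (k • x)) ∈ antiWeights (E := X) ρ :=
    comp_smul_mem_antiWeights hc
  constructor
  · intro hirr S hS _ a ha ha0 hSa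
    exact forall_apply_eq_zero_of_irreducible hAst hirr S hS ha ha0 hSa
  · intro hker W hWA hW0 hWst
    by_contra hWne
    obtain ⟨Q, hQ, hQW, hQid⟩ := exists_equivariant_projection (G := G) W hWst
    have hQodd : ∀ (f : X → ℚ) (x : X), Q f (ρ • x) = -Q f x := fun f x => (hmemA _).1 (hWA (hQW f)) x
    -- a non-zero odd vector killed by `Q`: `a − Q a` for `a ∈ Anti ∖ W`
    obtain ⟨a, haA, haW⟩ : ∃ a ∈ antiWeights (E := X) ρ, a ∉ W := by
      by_contra h
      push Not at h
      exact hWne (le_antisymm hWA fun a ha => h a ha)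
    have hmem : a - Q a ∈ antiWeights (E := X) ρ := (antiWeights (E := X) ρ).sub_mem haA (hWA (hQW a))
    have hne : a - Q a ≠ 0 := fun h => haW (by rw [sub_eq_zero.1 h]; exact hQW a)
    have hkill : Q (a - Q a) = 0 := by rw [map_sub, hQid _ (hQW a), sub_self]
    -- hence `Q` kills `Anti` — but `Q w = w ≠ 0` for `w ∈ W ∖ 0`
    obtain ⟨w, hw, hw0⟩ := (Submodule.ne_bot_iff W).1 hW0
    exact hw0 (by rw [← hQid w hw]; exact hker Q hQ hQodd _ hmem hne hkill w (hWA hw))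

/-- **THE SCHUR TEST IN WIELANDT COORDINATES.**  `G` transitive, `y_1, …, y_p ∉ {x₀, ρx₀}` representing the
non-self-conjugate orbit pairs of `Stab(x₀)` (the rest of `X ∖ {x₀, ρx₀}` self-conjugate), `T_j` the orbital operators:
(IRR) IFF every combination `c₀·(v ↦ v − v∘ρ) + Σ_j c_j·T_j` that kills a non-zero odd vector kills every odd vector.
[cite: Wielandt1964, Thm. 28.4] [cite: Serre1977, §2.2 Prop. 4] -/
theorem irreducible_iff_forall_coeffs [MulAction.IsPretransitive G X]
    (hc : ∀ (g : G) (x : X), g • ρ • x = ρ • g • x) (hi : ∀ x : X, ρ • ρ • x = x) (hρ : ∀ x : X, ρ • x ≠ x)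
    {p : ℕ} {x₀ : X} (y : Fin p → X) (hy₀ : ∀ j, y j ≠ x₀) (hy₀' : ∀ j, y j ≠ ρ • x₀)
    (hncs : ∀ j (g : G), g • x₀ = x₀ → g • y j ≠ ρ • y j)
    (hsep : ∀ j k, j ≠ k → ∀ g : G, g • x₀ = x₀ → g • y j ≠ y k ∧ g • y j ≠ ρ • y k)
    (hcover : ∀ x : X, x ≠ x₀ → x ≠ ρ • x₀ →
      (∃ g : G, g • x₀ = x₀ ∧ g • x = ρ • x) ∨ ∃ (j : Fin p) (g : G), g • x₀ = x₀ ∧ (g • y j = x ∨ g • y j = ρ • x))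
    (T : Fin p → ((X → ℚ) →ₗ[ℚ] (X → ℚ)))
    (hT : ∀ j (g : G) (f : X → ℚ), T j (fun x => f (g⁻¹ • x)) = fun x => T j f (g⁻¹ • x))
    (hTodd : ∀ j (f : X → ℚ) (x : X), T j f (ρ • x) = -T j f x)
    (hTδ : ∀ j (z : X), T j (fun y' => if y' = x₀ then (1 : ℚ) else 0) z =
      (if ∃ g : G, g • x₀ = x₀ ∧ g • y j = z then (1 : ℚ) else 0) -
        if ∃ g : G, g • x₀ = x₀ ∧ g • y j = ρ • z then (1 : ℚ) else 0) :
    (∀ W : Submodule ℚ (X → ℚ), W ≤ antiWeights (E := X) ρ → W ≠ ⊥ →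
      (∀ (k : G) (f : X → ℚ), f ∈ W → (fun y => f (k • y)) ∈ W) → W = antiWeights (E := X) ρ) ↔
    ∀ (c₀ : ℚ) (c : Fin p → ℚ), ∀ a ∈ antiWeights (E := X) ρ, a ≠ 0 →
      c₀ • (fun x => a x - a (ρ • x)) + ∑ j, c j • T j a = 0 →
      ∀ b ∈ antiWeights (E := X) ρ, c₀ • (fun x => b x - b (ρ • x)) + ∑ j, c j • T j b = 0 := by
  -- the combination as an odd-valued equivariant endomorphism
  let P : (X → ℚ) →ₗ[ℚ] (X → ℚ) := LinearMap.id - LinearMap.funLeft ℚ ℚ fun x : X => ρ • x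
  have hP : ∀ f, P f = fun x => f x - f (ρ • x) := fun f => rfl
  let L : ℚ → (Fin p → ℚ) → ((X → ℚ) →ₗ[ℚ] (X → ℚ)) := fun c₀ c => c₀ • P + ∑ j, c j • T j
  have hLapp : ∀ c₀ c f, L c₀ c f = c₀ • (fun x => f x - f (ρ • x)) + ∑ j, c j • T j f := fun c₀ c f => by
    simp only [L, LinearMap.add_apply, LinearMap.smul_apply, LinearMap.sum_apply, hP]
  have hLeq : ∀ c₀ c (g : G) (f : X → ℚ), L c₀ c (fun x => f (g⁻¹ • x)) = fun x => L c₀ c f (g⁻¹ • x) := by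
    intro c₀ c g f
    rw [hLapp, hLapp]
    funext x
    simp only [Pi.add_apply, Pi.smul_apply, Finset.sum_apply, smul_eq_mul, hc, hT _ g f]
  have hLodd : ∀ c₀ c (f : X → ℚ) (x : X), L c₀ c f (ρ • x) = -L c₀ c f x := by
    intro c₀ c f x
    rw [hLapp]
    simp only [Pi.add_apply, Pi.smul_apply, Finset.sum_apply, smul_eq_mul, hi, hTodd, mul_neg,
      Finset.sum_neg_distrib]
    ring
  rw [irreducible_iff_forall_ker hc]
  constructor
  · intro hker c₀ c a ha ha0 hLa b hb
    rw [← hLapp] at hLa ⊢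
    exact hker (L c₀ c) (hLeq c₀ c) (hLodd c₀ c) a ha ha0 hLa b hb
  · intro hcoef S hS hSodd a ha ha0 hSa b hb
    obtain ⟨c₀, c, hSexp⟩ := exists_coeffs_of_odd_equivariant hc hi hρ y hy₀ hy₀' hncs hsep hcover T hT hTodd hTδ
      S hS hSodd
    rw [hSexp] at hSa ⊢
    exact hcoef c₀ c a ha ha0 hSa b hb

end SchurTest

end Summit.HodgeConjecture.CorCM.IrrOdd

end
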